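import Literature.NumberTheory.Automorphic.AdelicUnitaryGroupSpectrum
import Literature.NumberTheory.Automorphic.AutomorphicQuotientKernelCompact
import Literature.NumberTheory.Automorphic.AutomorphicQuotientKernelConvolution
import HarnessLib

/-!
# FLOOR-0 ENGINE T1, line `F0_T1InnerFormTraceIdentity` — STUB S1 CLOSED: the trace functional `θ_{G′}` on `C_c(U(H)(𝔸))`

Cell hodgecm-mathlib (D-0183∕D-0185), FLOOR 0, crux item H413 = stmt-HodgeConjecture-24833; line
`Cruxes/H413/Lines/F0_T1InnerFormTraceIdentity.lean` (ed. 1.3, sha16 49b358693f779158; F0P3a-plan (g0), registrar A-plan1),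
registered stub `stub_T1a_traceFunctional : StubT1aTraceFunctional L H μ ν` (§4 there).  PROOF lane; seat F0P3a-p01 (g0), brief B1
of `F0/P3a/BRIEFS-T1-wave2.F0P3a-plan-g0.md`.  This file proves the REGISTERED declaration's TYPE, restated BINDER FOR BINDER (token-identically
to the body of `…Cruxes.H413.F0T1InnerFormTraceIdentity.StubT1aTraceFunctional`; the Lines module itself is not imported — crux workfiles are
not built on the farm), so that the line's next edition closes the hole BY NAME:
`theorem stub_T1a_traceFunctional : StubT1aTraceFunctional L H μ ν := F0P3aStubS1TraceFunctional.stubS1_holds L H μ ν`.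

## Content
For the unitary group `G′ = U(H)` of an ANISOTROPIC matrix `H ∈ M₃(L)` over a CM field `L` (datum `UnitaryGroup.cmDatum L 3 H`, compact
automorphic quotient `X = U(H)(𝔸_{L⁺}) ⧸ U(H)(L⁺)` by ★ `UnitaryGroup.compactSpace_cmDatum_automorphicQuotient`), an automorphic measure `μ`
and an inversion-invariant Haar measure `ν` on `U(H)(𝔸_{L⁺})`, there is a `ℂ`-LINEAR functional `θ` on `C_c(U(H)(𝔸_{L⁺}), ℂ)` such that for
every `f′` and every `F′ = f′ ⋆ f′^*` (pointwise) and every countable Hilbert basis `(e_i)` of `L²(X, μ)`: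
`Σ_i ‖R(f′) e_i‖² = Re θ(F′)` and `Im θ(F′) = 0` — i.e. `θ` IS «the trace of `ρ(f′ ⋆ f′^*)` on `L(G′)`» ([Rogawski1990] §14.5, in the
Hilbert–Schmidt form of [Gelbart1975] (9.11), Lemma 10.6 that needs no trace-class theory).

The functional is EXPLICIT: `θ(F) = c⁻¹ ∫_X K_F(x, x) dμ(x)` with `K_F(x̃H, ỹH) = Σ_{γ ∈ U(H)(L⁺)} F(x̃ γ⁻¹ ỹ⁻¹)` the automorphic kernel of
the tree (`quotientKernel` for the counting measure `ρ = count` on the discrete subgroup `U(H)(L⁺)`, ★ `UnitaryGroup.cmDatum_quotientSubgroup`,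
★ `discreteTopology_adelicUnitaryRat`) and `c = unfoldingConstant` of `(count, μ, ν)`; the Hilbert–Schmidt clause is the tree's ★
`AdelicGroupData.hasSum_norm_sq_integratedOperator_rightRegular_eq_diagonal` (`AutomorphicQuotientKernelConvolution`).  New here (generic, any
closed unimodular `H ≤ G`): `quotientKernel` is ADDITIVE and HOMOGENEOUS in the test function (`quotientKernel_add`, `quotientKernel_const_smul`,
via `integrable_comp_mul_inv_coe_mul_inv`), the diagonal `x ↦ K_F(x, x)` is integrable on a compact automorphic quotient,
and the generic existence statement `exists_traceFunctional` for ANY adelic group datum with compact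
automorphic quotient and closed unimodular `A_G · G(K)`; the closer `stubS1_holds` specialises it to `cmDatum L 3 H` with `ρ = count`.
Rider (a) of the brief: `mulConvMulStar_nonvacuous` — for every `f′ ∈ C_c` the function `f′ ⋆ f′^*` IS again in `C_c` (★
`continuous_mulConv`, ★ `hasCompactSupport_mulConv`, ★ `…_mulStar`), so the clause quantifies over a non-empty set of pairs `(f′, F′)`.

HONEST LABEL: HC_CM is proved only modulo the printed citations until rung 0 closes; this closes ONE of the three registered stubs (S1) of ONE
floor-0 line (S2, S3 open); T1 as a whole is a PROGRAMME.  Mathlib-only footing: no named-fact hypothesis, no `sorry`.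

## References
* [Rogawski1990] J. Rogawski, *Automorphic Representations of Unitary Groups in Three Variables*, Ann. of Math. Stud. 123 (1990), §14.5
  p. 237 (print): «Since `G′` is anisotropic, `T_{G′}(f′)` is the trace of `ρ(f′)` on `L(G′)`».
* [Gelbart1975] S. Gelbart, *Automorphic forms on adele groups*, Ann. of Math. Stud. 83 (1975), (9.11), Lemma 10.6, (10.10).
* [GelfandGraevPiatetskiShapiro1969] I. M. Gelfand, M. I. Graev, I. I. Piatetski-Shapiro, *Representation theory and automorphic functions*
  (1969), Ch. 1 §2 (the kernel `K(x, y) = Σ_γ f(x⁻¹ γ y)` on a compact quotient).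
-/

set_option autoImplicit false
set_option linter.dupNamespace false

noncomputable section

namespace Summit.HodgeConjecture.HodgeConjecture.Cruxes.H413.F0P3aStubS1TraceFunctional

open MeasureTheory Measure Set Filter Topology NumberField IsDedekindDomain CompactlySupported
open Literature.NumberTheory.Automorphic
open Literature.MeasureTheory.Group
open Literature.AlgebraicGeometry.ShimuraVarieties (hermForm)
open scoped ENNReal NNReal

/-! ## §1 Linearity of the automorphic kernel in the test function (generic closed unimodular `Γ ≤ G`) -/

section Integrand

variable {G : Type*} [Group G] [TopologicalSpace G] [IsTopologicalGroup G] [MeasurableSpace G] [BorelSpace G]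
  (Γ : Subgroup G) [hΓ : IsClosed (Γ : Set G)] (ρ : Measure Γ) [IsFiniteMeasureOnCompacts ρ]
  {𝕜 : Type*} [RCLike 𝕜]

/-- The integrand `h ↦ f(x̃ h⁻¹ ỹ⁻¹)` of the automorphic kernel `K_f(x̃, ỹΓ) = ∫_Γ f(x̃ h⁻¹ ỹ⁻¹) dρ(h)` is `ρ`-integrable for `f ∈ C_c(G)`
and a closed subgroup `Γ` (it is `f` composed with the closed embedding `h ↦ x̃ h⁻¹ ỹ⁻¹ : Γ → G`, hence continuous with compact support,
and `ρ` is finite on compact sets). [folklore] -/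
theorem integrable_comp_mul_inv_coe_mul_inv {f : G → 𝕜} (hf : Continuous f) (hfs : HasCompactSupport f)
    (x₀ y₀ : G) : Integrable (fun h : Γ => f (x₀ * (h : G)⁻¹ * y₀⁻¹)) ρ := by
  have hφ : IsClosedEmbedding (fun h : Γ => x₀ * (h : G)⁻¹ * y₀⁻¹) :=
    (Homeomorph.mulRight y₀⁻¹).isClosedEmbedding.comp ((Homeomorph.mulLeft x₀).isClosedEmbedding.comp
      ((Homeomorph.inv G).isClosedEmbedding.comp hΓ.isClosedEmbedding_subtypeVal))
  exact (hf.comp hφ.continuous).integrable_of_hasCompactSupport (hfs.comp_isClosedEmbedding hφ)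

end Integrand

section KernelLinearity

variable {G : Type*} [Group G] [TopologicalSpace G] [IsTopologicalGroup G] [LocallyCompactSpace G]
  [SecondCountableTopology G] [T2Space G] [MeasurableSpace G] [BorelSpace G]
  (Γ : Subgroup G) [hΓ : IsClosed (Γ : Set G)]
  (ρ : Measure Γ) [ρ.IsMulLeftInvariant] [SFinite ρ] [IsFiniteMeasureOnCompacts ρ]
  [MeasurableSpace (G ⧸ Γ)] [BorelSpace (G ⧸ Γ)]
  {𝕜 : Type*} [RCLike 𝕜]

/-- **The automorphic kernel is additive in the test function** (as a function of a lift of the first variable):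
`K_{f+g}(x̃, y) = K_f(x̃, y) + K_g(x̃, y)` for `f, g ∈ C_c(G)`. [folklore] -/
theorem cosetKernel_add {f g : G → 𝕜} (hf : Continuous f) (hfs : HasCompactSupport f) (hg : Continuous g)
    (hgs : HasCompactSupport g) (x₀ : G) (y : G ⧸ Γ) :
    cosetKernel Γ ρ (f + g) x₀ y = cosetKernel Γ ρ f x₀ y + cosetKernel Γ ρ g x₀ y := by
  induction y using QuotientGroup.induction_on with
  | H y₀ =>
    rw [cosetKernel_mk, cosetKernel_mk, cosetKernel_mk, ← integral_add
      (integrable_comp_mul_inv_coe_mul_inv Γ ρ hf hfs x₀ y₀) (integrable_comp_mul_inv_coe_mul_inv Γ ρ hg hgs x₀ y₀)]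
    rfl

omit [IsFiniteMeasureOnCompacts ρ] in
/-- **The automorphic kernel is homogeneous in the test function**: `K_{a f}(x̃, y) = a K_f(x̃, y)`. [folklore] -/
theorem cosetKernel_const_smul (a : 𝕜) (f : G → 𝕜) (x₀ : G) (y : G ⧸ Γ) :
    cosetKernel Γ ρ (a • f) x₀ y = a * cosetKernel Γ ρ f x₀ y := by
  induction y using QuotientGroup.induction_on with
  | H y₀ =>
    rw [cosetKernel_mk, cosetKernel_mk, ← integral_const_mul]
    rfl

variable [ρ.IsMulRightInvariant]

/-- **Additivity of the kernel on `(G ⧸ Γ) × (G ⧸ Γ)`** (unimodular `Γ`): `K_{f+g}(x, y) = K_f(x, y) + K_g(x, y)` for `f, g ∈ C_c(G)`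
(Gelfand–Graev–Piatetski-Shapiro's `K(x, y) = Σ_γ f(x⁻¹ γ y)` is linear in `f`). [cite: GelfandGraevPiatetskiShapiro1969, Ch. 1 §2] -/
theorem quotientKernel_add {f g : G → 𝕜} (hf : Continuous f) (hfs : HasCompactSupport f) (hg : Continuous g)
    (hgs : HasCompactSupport g) (x y : G ⧸ Γ) :
    quotientKernel Γ ρ (f + g) x y = quotientKernel Γ ρ f x y + quotientKernel Γ ρ g x y := by
  induction x using QuotientGroup.induction_on with
  | H x₀ =>
    rw [quotientKernel_mk, quotientKernel_mk, quotientKernel_mk]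
    exact cosetKernel_add Γ ρ hf hfs hg hgs x₀ y

omit [IsFiniteMeasureOnCompacts ρ] in
/-- **Homogeneity of the kernel on `(G ⧸ Γ) × (G ⧸ Γ)`**: `K_{a f}(x, y) = a K_f(x, y)`. [cite: GelfandGraevPiatetskiShapiro1969, Ch. 1 §2] -/
theorem quotientKernel_const_smul (a : 𝕜) (f : G → 𝕜) (x y : G ⧸ Γ) :
    quotientKernel Γ ρ (a • f) x y = a * quotientKernel Γ ρ f x y := by
  induction x using QuotientGroup.induction_on with
  | H x₀ =>
    rw [quotientKernel_mk, quotientKernel_mk]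
    exact cosetKernel_const_smul Γ ρ a f x₀ y

end KernelLinearity

/-! ## §2 The trace functional of an adelic group datum with compact automorphic quotient -/

section Datum

universe u

variable {K : Type} [Field K] [NumberField K] (𝒢 : AdelicGroupData.{u} K)
  (μ : Measure 𝒢.automorphicQuotient) [𝒢.IsAutomorphicMeasure μ]
  [LocallyCompactSpace 𝒢.Adelic] [SecondCountableTopology 𝒢.Adelic] [T2Space 𝒢.Adelic]
  [MeasurableSpace 𝒢.Adelic] [BorelSpace 𝒢.Adelic]
  [hH : IsClosed (𝒢.quotientSubgroup : Set 𝒢.Adelic)]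
  (ρ : Measure 𝒢.quotientSubgroup) [ρ.IsMulLeftInvariant] [ρ.IsMulRightInvariant] [ρ.IsInvInvariant]
  [IsFiniteMeasureOnCompacts ρ] [SFinite ρ]
  (ν : Measure 𝒢.Adelic) [IsHaarMeasure ν] [ν.IsInvInvariant]

/-- **The trace functional `θ(F) = c⁻¹ ∫_X K_F(x, x) dμ(x)` of an adelic group datum with compact automorphic quotient.**  For `𝒢`
with `G(𝔸_K)` locally compact second countable Hausdorff, `H = A_G · G(K)` closed and unimodular (`ρ ≠ 0` a two-sided and
inversion-invariant measure on it, finite on compact sets), `μ` automorphic, `ν` an inversion-invariant Haar measure and `X` compact, there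
is a `ℂ`-LINEAR functional `θ` on `C_c(G(𝔸_K), ℂ)` such that for every `f ∈ C_c`, every `F ∈ C_c` agreeing pointwise with `f ⋆ f^*`, and
every countable Hilbert basis `(e_i)` of `L²(X, μ)`: `Σ_i ‖R(f) e_i‖² = Re θ(F)` and `Im θ(F) = 0`.  The proof takes
`θ(F) := c⁻¹ ∫_X K_F(x, x) dμ(x)`, `K_F = quotientKernel H ρ F` the tree's automorphic kernel, `c = unfoldingConstant H ρ μ ν` — linear by
`quotientKernel_add` ∕ `quotientKernel_const_smul` and the integrability of the continuous bounded diagonal (★ `exists_norm_quotientKernel_le'`,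
★ `stronglyMeasurable_uncurry_quotientKernel`) — and the clause is ★ `hasSum_norm_sq_integratedOperator_rightRegular_eq_diagonal`
(Gelbart's (9.11) with Lemma 10.6: `tr R(f ⋆ f^*) = ∫_X K_{f⋆f^*}(x, x) dx`, a sum of squares, hence real).
[cite: Gelbart1975, (9.11) and Lemma 10.6] -/
theorem exists_traceFunctional [CompactSpace 𝒢.automorphicQuotient] (hρ : ρ ≠ 0) :
    ∃ θ : C_c(𝒢.Adelic, ℂ) →ₗ[ℂ] ℂ,
      ∀ (f' F' : C_c(𝒢.Adelic, ℂ)), (∀ x, F' x = mulConv ν (⇑f') (mulStar (⇑f')) x) →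
        ∀ {ι : Type} [Countable ι] (b : HilbertBasis ι ℂ (𝒢.L2 μ)),
          HasSum (fun i => (‖(𝒢.rightRegular μ).integratedOperator (𝒢.isUnitary_rightRegular μ)
              (𝒢.isStronglyContinuous_rightRegular_holds μ) ν f' (b i)‖ ^ 2 : ℝ)) (θ F').re ∧ (θ F').im = 0 := by
  -- the tree's Borel structure, invariance and finiteness of `μ`, keyed on the syntactic form `G(𝔸_K) ⧸ (A_G · G(K))`
  letI : MeasurableSpace (𝒢.Adelic ⧸ 𝒢.quotientSubgroup) := AdelicGroupData.measurableSpaceQuotientForm 𝒢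
  haveI : BorelSpace (𝒢.Adelic ⧸ 𝒢.quotientSubgroup) := AdelicGroupData.borelSpaceQuotientForm 𝒢
  haveI : SMulInvariantMeasure 𝒢.Adelic (𝒢.Adelic ⧸ 𝒢.quotientSubgroup) μ :=
    AdelicGroupData.smulInvariantMeasureQuotientForm 𝒢 μ
  haveI : @IsFiniteMeasureOnCompacts (𝒢.Adelic ⧸ 𝒢.quotientSubgroup) _ _ μ :=
    AdelicGroupData.isFiniteMeasureOnCompactsQuotientForm 𝒢 μ
  haveI : @IsFiniteMeasure (𝒢.Adelic ⧸ 𝒢.quotientSubgroup) _ μ := AdelicGroupData.isFiniteMeasureQuotientForm 𝒢 μ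
  haveI : CompactSpace (𝒢.Adelic ⧸ 𝒢.quotientSubgroup) := ‹CompactSpace 𝒢.automorphicQuotient›
  -- the diagonal `x ↦ K_F(x, x)` is integrable (continuous and bounded on a space of finite measure)
  have hint : ∀ F : C_c(𝒢.Adelic, ℂ),
      Integrable (fun x : 𝒢.automorphicQuotient => quotientKernel 𝒢.quotientSubgroup ρ F x x) μ := by
    intro F
    obtain ⟨C, hC⟩ := AdelicGroupData.exists_norm_quotientKernel_le' 𝒢 ρ F
    have hK := AdelicGroupData.stronglyMeasurable_uncurry_quotientKernel 𝒢 ρ F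
    have hm : AEStronglyMeasurable
        (fun x : 𝒢.automorphicQuotient => quotientKernel 𝒢.quotientSubgroup ρ F x x) μ :=
      (hK.comp_measurable (measurable_id.prodMk measurable_id)).aestronglyMeasurable
    exact (integrable_const C).mono' hm (Eventually.of_forall fun x => hC x x)
  -- additivity and homogeneity of the diagonal integral
  have hadd : ∀ F G : C_c(𝒢.Adelic, ℂ),
      ∫ x, quotientKernel 𝒢.quotientSubgroup ρ (⇑(F + G)) x x ∂μ =
        ∫ x, quotientKernel 𝒢.quotientSubgroup ρ F x x ∂μ + ∫ x, quotientKernel 𝒢.quotientSubgroup ρ G x x ∂μ := by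
    intro F G
    refine (integral_congr_ae (Eventually.of_forall fun x => ?_)).trans (integral_add (hint F) (hint G))
    change quotientKernel 𝒢.quotientSubgroup ρ (⇑(F + G)) x x =
      quotientKernel 𝒢.quotientSubgroup ρ F x x + quotientKernel 𝒢.quotientSubgroup ρ G x x
    rw [CompactlySupportedContinuousMap.coe_add]
    exact quotientKernel_add 𝒢.quotientSubgroup ρ F.continuous F.hasCompactSupport G.continuous
      G.hasCompactSupport x x
  have hsmul : ∀ (a : ℂ) (F : C_c(𝒢.Adelic, ℂ)),
      ∫ x, quotientKernel 𝒢.quotientSubgroup ρ (⇑(a • F)) x x ∂μ =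
        a * ∫ x, quotientKernel 𝒢.quotientSubgroup ρ F x x ∂μ := by
    intro a F
    refine (integral_congr_ae (Eventually.of_forall fun x => ?_)).trans
      (integral_const_mul a fun x => quotientKernel 𝒢.quotientSubgroup ρ F x x)
    change quotientKernel 𝒢.quotientSubgroup ρ (⇑(a • F)) x x = a * quotientKernel 𝒢.quotientSubgroup ρ F x x
    rw [CompactlySupportedContinuousMap.coe_smul]
    exact quotientKernel_const_smul 𝒢.quotientSubgroup ρ a (⇑F) x x
  -- the functional
  refine ⟨{ toFun := fun F => (((unfoldingConstant 𝒢.quotientSubgroup ρ μ ν : ℝ)⁻¹ : ℂ)) *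
              ∫ x, quotientKernel 𝒢.quotientSubgroup ρ F x x ∂μ
            map_add' := fun F G => by rw [hadd, mul_add]
            map_smul' := fun a F => by rw [hsmul, RingHom.id_apply, smul_eq_mul, mul_left_comm] }, ?_⟩
  -- the Hilbert–Schmidt clause
  intro f' F' hF' ι _ b
  have hFeq : (⇑F' : 𝒢.Adelic → ℂ) = mulConv ν (⇑f') (mulStar (⇑f')) := funext hF'
  have h1 := AdelicGroupData.hasSum_norm_sq_integratedOperator_rightRegular_eq_diagonal 𝒢 μ ρ ν hρ f' b
  rw [← hFeq] at h1
  obtain ⟨hre, him⟩ := (Complex.hasSum_iff _ _).1 h1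
  simp only [Complex.ofReal_re, Complex.ofReal_im] at hre him
  exact ⟨hre, him.unique hasSum_zero⟩

end Datum

/-! ## §3 The closer for `U(H)`, `H ∈ M₃(L)` anisotropic over a CM field -/

section Closer

/-- Rider (non-vacuity of the clause): for every `f′ ∈ C_c(G, ℂ)` on a locally compact second countable group the function `f′ ⋆ f′^*`
is again continuous with compact support, so there IS an `F′ ∈ C_c` with `F′ = f′ ⋆ f′^*` pointwise (★ `continuous_mulConv`,
★ `hasCompactSupport_mulConv`, ★ `continuous_mulStar`, ★ `hasCompactSupport_mulStar`). [cite: Gelbart1975, Lemma 10.6] -/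
theorem mulConvMulStar_nonvacuous {G : Type*} [Group G] [TopologicalSpace G] [IsTopologicalGroup G] [MeasurableSpace G]
    [BorelSpace G] [LocallyCompactSpace G] [SecondCountableTopology G] (ν : Measure G) [IsFiniteMeasureOnCompacts ν]
    (f' : C_c(G, ℂ)) : ∃ F' : C_c(G, ℂ), ∀ x, F' x = mulConv ν (⇑f') (mulStar (⇑f')) x :=
  ⟨⟨⟨mulConv ν (⇑f') (mulStar (⇑f')), continuous_mulConv ν f'.continuous f'.hasCompactSupport
      (continuous_mulStar f'.continuous)⟩,
    hasCompactSupport_mulConv ν f'.hasCompactSupport (hasCompactSupport_mulStar f'.hasCompactSupport)⟩, fun _ => rfl⟩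

variable (L : Type) [Field L] [NumberField L] [IsCMField L] (H : Matrix (Fin 3) (Fin 3) L)

/-- `U(H)(L⁺) = A_G · U(H)(L⁺)` (`A_G = 1`) is a DISCRETE subgroup of `U(H)(𝔸_{L⁺})` (★ `cmDatum_quotientSubgroup`,
★ `discreteTopology_adelicUnitaryRat`). [folklore] -/
theorem discreteTopology_cmDatum_quotientSubgroup :
    DiscreteTopology (UnitaryGroup.cmDatum L 3 H).quotientSubgroup := by
  rw [UnitaryGroup.cmDatum_quotientSubgroup]
  exact discreteTopology_adelicUnitaryRat L H

variable [MeasurableSpace (UnitaryGroup.cmDatum L 3 H).Adelic] [BorelSpace (UnitaryGroup.cmDatum L 3 H).Adelic]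
  (μ : Measure (UnitaryGroup.cmDatum L 3 H).automorphicQuotient) [(UnitaryGroup.cmDatum L 3 H).IsAutomorphicMeasure μ]
  (ν : Measure (UnitaryGroup.cmDatum L 3 H).Adelic) [ν.IsHaarMeasure] [ν.IsInvInvariant]

/-- **STUB S1 of line `F0_T1InnerFormTraceIdentity`, proved** — the body of `StubT1aTraceFunctional L H μ ν` binder for binder: for
anisotropic `H`, the trace functional `θ(F) = c⁻¹ ∫_X K_F(x, x) dμ` (kernel for the counting measure on the discrete subgroup `U(H)(L⁺)`,
`exists_traceFunctional` at `cmDatum L 3 H`; compactness ★ `compactSpace_cmDatum_automorphicQuotient`) is `ℂ`-linear on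
`C_c(U(H)(𝔸_{L⁺}), ℂ)` and reproduces the Hilbert–Schmidt norm `Σ_i ‖R(f′) e_i‖²` on every `f′ ⋆ f′^*`, with vanishing imaginary part
([Rogawski1990] §14.5: «`T_{G′}(f′)` is the trace of `ρ(f′)` on `L(G′)`», in the form of [Gelbart1975] (9.11), Lemma 10.6).
[cite: Rogawski1990, §14.5 p. 237] [cite: Gelbart1975, (9.11) and Lemma 10.6] -/
theorem stubS1_holds :
    (∀ x : Fin 3 → L, hermForm (cmConjRingHom L) H x x = 0 → x = 0) →
    ∃ θ : CompactlySupportedContinuousMap (UnitaryGroup.cmDatum L 3 H).Adelic ℂ →ₗ[ℂ] ℂ,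
      ∀ (f' F' : CompactlySupportedContinuousMap (UnitaryGroup.cmDatum L 3 H).Adelic ℂ),
        (∀ x, F' x = mulConv ν (⇑f') (mulStar (⇑f')) x) →
        ∀ {ι : Type} [Countable ι] (b : HilbertBasis ι ℂ ((UnitaryGroup.cmDatum L 3 H).L2 μ)),
          HasSum (fun i => (‖((UnitaryGroup.cmDatum L 3 H).rightRegular μ).integratedOperator
              ((UnitaryGroup.cmDatum L 3 H).isUnitary_rightRegular μ)
              ((UnitaryGroup.cmDatum L 3 H).isStronglyContinuous_rightRegular_holds μ) ν f' (b i)‖ ^ 2 : ℝ))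
            (θ F').re ∧ (θ F').im = 0 := by
  intro hanis
  haveI : CompactSpace (UnitaryGroup.cmDatum L 3 H).automorphicQuotient :=
    UnitaryGroup.compactSpace_cmDatum_automorphicQuotient L 3 H hanis
  haveI : DiscreteTopology (UnitaryGroup.cmDatum L 3 H).quotientSubgroup :=
    discreteTopology_cmDatum_quotientSubgroup L H
  haveI hH : IsClosed ((UnitaryGroup.cmDatum L 3 H).quotientSubgroup : Set (UnitaryGroup.cmDatum L 3 H).Adelic) :=
    Subgroup.isClosed_of_discrete
  haveI : Countable (UnitaryGroup.cmDatum L 3 H).quotientSubgroup :=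
    TopologicalSpace.separableSpace_iff_countable.1 inferInstance
  haveI : IsFiniteMeasureOnCompacts (Measure.count : Measure (UnitaryGroup.cmDatum L 3 H).quotientSubgroup) :=
    ⟨fun k hk => Measure.count_apply_lt_top.2 hk.finite_of_discrete⟩
  exact exists_traceFunctional (UnitaryGroup.cmDatum L 3 H) μ
    (Measure.count : Measure (UnitaryGroup.cmDatum L 3 H).quotientSubgroup) ν (NeZero.ne _)

end Closer

end Summit.HodgeConjecture.HodgeConjecture.Cruxes.H413.F0P3aStubS1TraceFunctional

end
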